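import Summits.QuantumFields.BalabanUV.T4Continuum.Support.GradedWellTorusTransfer
import Summits.QuantumFields.BalabanUV.T4Continuum.Support.GradedWellGram
import Summits.QuantumFields.BalabanUV.T4Continuum.Support.GradedWellScalarCoercive
import Summits.QuantumFields.BalabanUV.T4Continuum.Support.ScalarGaugeProjectionUnit
import Summits.QuantumFields.BalabanUV.T4Continuum.Support.CovariantBlockAveraging
import Summits.QuantumFields.BalabanUV.T4Continuum.Support.GradedWellResolventTower
import Summits.QuantumFields.BalabanUV.T4Continuum.Support.GradedLineAveragingBounds
import Summits.QuantumFields.BalabanUV.T4Continuum.Support.BalabanBlockPoincare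
import Literature.MathematicalPhysics.QuantumFieldTheory.Balaban1983to89.B5DeltaA169

/-!
# T⁴ programme, spine node NE2 (U1a), sub-row Δ1 — THE GRADED WELL, file 8: THE DIFFERENCE `E_k = Δ_a^{(k)} − regionGW_k` IS
# BOUNDED, LEVEL-FREE — `‖E_k‖ ≤ eGW(d, L, m, a, a′)` for EVERY level `k` (owner item O17-a, ruling R50 (e); discharges the
# hypothesis `hE` of `GradedWellTorusTransfer.hinjK_GW_of_torus` and of leaf-06-g8's `GradedWellTowerAssembly.freeTowerLaws_GW_of_torus`)

Row NE2 OWNER (unit `b2b-balaban-t4-ne2-p1`, gen 17).  The torus transfer (file 7, R49) reads the graded-well tower off Bałaban's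
faithful unit torus operator `Δ_a^{(k)} = calDalev k` through the LEVEL-FREE-RANK difference `E_k = EGW k = Δ_a^{(k)} − regionGW_k` and
needs three inputs: coercivity of `regionGW` ((GW-W1) + (GW-S0) ✓), **`‖E_k‖ ≤ e` level-free** (THIS FILE), and one two-level leaf (GW-E).

 * §1 **THE IDENTITY** `EGW_eq`: `E_k = B_k·K_k⁻¹·B_kᴴ − ∂·P_T·∂ᴴ + a·Q*Q − a·Q_GWᴴQ_GW` — the graded gauge sandwich
   (`GradedWellTwoLevel.BhGW`/`KGW`, the O15 split `regionGW = localGW − B·K⁻¹·Bᴴ` + the exact Weitzenböck `localGW = LapV + a·Q_GWᴴQ_GW`)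
   minus the TORUS gauge sandwich `∂·PcT·∂ᴴ` of [B5] (1.69)/(1.70) plus the unit line mass `a·Q*_kQ_k` (`QvAdj·QvOp`, (1.69)) minus the
   graded line mass; from `calDalev = calDa = DeltaA = Lap − ∂·PcT·∂ᴴ + a·Q*Q` (`B5DeltaA169.calDa_eq_DeltaA`, `Lap = LapV`).
 * §2 THE FOUR LEVEL-FREE NORMS: `‖B·K⁻¹·Bᴴ‖ ≤ gamGW⁻¹·sigGW⁻²` (file 5 `GradedWellResolventTower.opNorm_BhGW_le`/`opNorm_sandwich_le`,
   O16-e `opNorm_GOmGW_le`, leaf-05-g10 `GradedWellGram.opNorm_inv_gramK_GW_le`); `‖∂·PcT·∂ᴴ‖ ≤ γ′⁻¹·σ₀⁻²` (the substrate's torus factorisation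
   `∂·PcT·∂ᴴ = ∂·Pone·∂ᴴ`, `Pone = G′Q̃′ᴴKcomp⁻¹Q̃′G′`: `ScalarGaugeProjectionUnit`, `‖∂G′‖ ≤ √(γ′⁻¹)`, `‖Kcomp⁻¹‖ ≤ σ₀⁻²`); `‖a·Q*Q‖ ≤ a`
   (`CovariantBlockAveraging.opNorm_QvOp_le`); `‖Q_GWᴴQ_GW‖ ≤ Σ_{i≤m} L^{2i}` (§2c `opNorm_massGW_le`: every typed row of `RowV` is a row — the subtype sum is at most the sigma-type sum —
   and per scale `w_i²·‖Q_{s_i}‖² ≤ L^{2i}` by leaf-01-g11's Schur bound `GradedLineAveragingBounds.opNorm_avgS_le` `‖Q_s‖ ≤ s^{−d/2}`).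
 * §3 **`opNorm_EGW_le (hlay) (ha′) (k) : ‖EGW L M k m layer a a′ ha‖ ≤ eGW d L m a a′`** for EVERY `k` (not only `k ≥ m`),
   `eGW := gamGW⁻¹·sigGW⁻² + γ′⁻¹·σ₀⁻² + a·(1 + Σ_{i≤m} L^{2i})` depending on `d, L, m, a, a′` ONLY; and the torus transfer with `hE`
   DISCHARGED: **`hinjK_GW_of_torus_E (hlay) (ha′) (hγ) (hθ) (hco) (hEc)`**.

HONEST FRAMING (T4-DAG p. 1).  [folklore] bookkeeping + one Schur test at model level (`U = 1`, ONE layer map on UNIT blocks, `m` fixed, finite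
torus, operator norm); constants OURS; `[cite:]` tags locate SHAPES; nothing printed is a hypothesis or a conclusion; NE2 (U1a) NOT proved; spine
PROVED 0/9 unchanged; NOT [B9] (3.16)/(3.23)–(3.27)/(3.42) as printed; NOT infinite volume / mass gap / Clay.  HONEST DEPENDENCY: continuum YM
on T⁴ ⇐ BetaPertH ∧ nine spine estimates (0/9 proved); BetaPertH ⇐ (D1) ∧ (D4) ∧ CAP+tail; G-an2-4 gates asym, D1 and NE2/3/4.  No `sorry`.
-/

noncomputable section

open scoped BigOperators ComplexConjugate Matrix Matrix.Norms.L2Operator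
open Finset

namespace Summit.QuantumFields.BalabanUV.T4Continuum.GradedWellDifference

open Literature.MathematicalPhysics.QuantumFieldTheory.Balaban1983to89.B5Prop11Plancherel (Tor fine unitVec)
open Literature.MathematicalPhysics.QuantumFieldTheory.Balaban1983to89.B5Prop11Lower (nsq nsq_nonneg)
open Literature.MathematicalPhysics.QuantumFieldTheory.Balaban1983to89.B5Block118 (QvOp tstep)
open Literature.MathematicalPhysics.QuantumFieldTheory.Balaban1983to89.B5Action121 (GradOp LapV Lap_eq_LapV)
open Literature.MathematicalPhysics.QuantumFieldTheory.Balaban1983to89.B5Value126 (PcT)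
open Literature.MathematicalPhysics.QuantumFieldTheory.Balaban1983to89.B5DeltaA169 (DeltaA QvAdj calDa_eq_DeltaA)
open Literature.MathematicalPhysics.QuantumFieldTheory.Balaban1983to89.B5G183RateUnitTower (lev lev_neZero)
open Summit.QuantumFields.BalabanUV.T4Continuum
open Summit.QuantumFields.BalabanUV.T4Continuum.SubtypeCompression (Coercive)
open Summit.QuantumFields.BalabanUV.T4Continuum.KingPairingPlantedLaw (JpcT calDalev)
open Summit.QuantumFields.BalabanUV.T4Continuum.RegionGaugeProjection (gramK gaugeP)
open Summit.QuantumFields.BalabanUV.T4Continuum.ScalarAveragedPropagator (Gps gammaPs gammaPs_pos Gps_isHermitian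
  opNorm_GradOp_mul_Gps_le opNorm_le_of_nsq_le_rect)
open Summit.QuantumFields.BalabanUV.T4Continuum.ScalarAveragedCompression (Qiso Kcomp sigma0 sigma0_pos opNorm_Qiso_le
  opNorm_Kcomp_inv_le)
open Summit.QuantumFields.BalabanUV.T4Continuum.ScalarGaugeProjectionUnit (Pone Pone_eq_iso GradOp_Pone_GradOpH_eq)
open Summit.QuantumFields.BalabanUV.T4Continuum.CovariantBlockAveraging (opNorm_QvOp_le)
open Summit.QuantumFields.BalabanUV.T4Continuum.GradedWellData
open Summit.QuantumFields.BalabanUV.T4Continuum.GradedWellSlice (QsGWn)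
open Summit.QuantumFields.BalabanUV.T4Continuum.GradedWellScalarCoercive (gamGW gamGW_pos isUnit_det_DpGW opNorm_GOmGW_le)
open Summit.QuantumFields.BalabanUV.T4Continuum.GradedWellGram (sigGW sigGW_pos opNorm_inv_gramK_GW_le)
open Summit.QuantumFields.BalabanUV.T4Continuum.GradedWellTwoLevel (BhGW KGW regionGW_eq_localGW_sub_sandwich')
open Summit.QuantumFields.BalabanUV.T4Continuum.GradedWellResolventTower (opNorm_BhGW_le opNorm_sandwich_le)
open Summit.QuantumFields.BalabanUV.T4Continuum.GradedLineAveragingBounds (opNorm_avgS_le)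
open Summit.QuantumFields.BalabanUV.T4Continuum.BalabanBlockPoincare (nsq_mulVec_le_rect)
open Summit.QuantumFields.BalabanUV.T4Continuum.GradedSubBlocks (Anc avgS shiftAnc s_pos)
open Literature.MathematicalPhysics.QuantumFieldTheory.Balaban1983to89.B5Blocks16 (blockOf)
open Summit.QuantumFields.BalabanUV.T4Continuum.GradedWellTorusTransfer (EGW C1T hinjK_GW_of_torus)

variable {d : ℕ}

/-! ## §1 The identity: graded gauge sandwich − torus gauge sandwich + unit line mass − graded line mass -/

section Identity

variable (L : ℕ) [NeZero L] (M : Fin d → ℕ) [hM : ∀ μ, NeZero (M μ)] (k m : ℕ) (layer : Tor M → ℕ) (a a' : ℝ) (ha : 0 < a)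

/-- **THE DIFFERENCE, EXACTLY**: `E_k = Δ_a^{(k)} − regionGW_k = B_k·K_k⁻¹·B_kᴴ − ∂·P_T·∂ᴴ + a·Q*_kQ_k − a·Q_GWᴴQ_GW` (the componentwise
Laplacians cancel: `Δ_a = Lap − ∂P∂* + aQ*Q` (1.69)/(1.73) and `regionGW = LapV + a·Q_GWᴴQ_GW − B·K⁻¹·Bᴴ`).
[cite: Balaban1984PropagatorsI, (1.69) p.29, (1.70) p.30 (shape)] [folklore] -/
theorem EGW_eq :
    EGW L M k m layer a a' ha
      = BhGW L M k m layer a' * (KGW L M k m layer a')⁻¹ * (BhGW L M k m layer a')ᴴ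
        - gradT L M k * PcT (lev L k) M ((lev L k : ℕ) : ℂ) * (gradT L M k)ᴴ
        + (a : ℂ) • (QvAdj (lev L k) M * QvOp (lev L k) M)
        - (a : ℂ) • ((QvGW L M k m layer)ᴴ * QvGW L M k m layer) := by
  unfold EGW
  rw [regionGW_eq_localGW_sub_sandwich', localGW_eq]
  have h1 : calDalev L M a ha k = DeltaA (lev L k) M a := by
    unfold calDalev; exact calDa_eq_DeltaA _ _ _ _ _
  rw [h1, DeltaA, Lap_eq_LapV]
  abel

end Identity

/-! ## §2a The graded gauge sandwich `B·K⁻¹·Bᴴ` -/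

section GaugeGW

variable (L : ℕ) [NeZero L] (M : Fin d → ℕ) [hM : ∀ μ, NeZero (M μ)] (k m : ℕ) (layer : Tor M → ℕ) (a' : ℝ)

/-- **THE GRADED GAUGE SANDWICH IS BOUNDED, LEVEL-FREE**: `‖B_k·K_k⁻¹·B_kᴴ‖ ≤ gamGW⁻¹·sigGW⁻²` (file 5's `‖B_k‖ ≤ √‖G′_GW‖`, O16-e's
`‖G′_GW‖ ≤ gamGW⁻¹`, leaf-05-g10's `‖K_k⁻¹‖ ≤ sigGW⁻²`). [cite: Balaban1985BackgroundPropagators, (3.25) p.394 (shape)] [folklore] -/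
theorem opNorm_sandwichGW_le (hlay : ∀ y, layer y ≤ m) (ha' : 0 < a') :
    ‖BhGW L M k m layer a' * (KGW L M k m layer a')⁻¹ * (BhGW L M k m layer a')ᴴ‖
      ≤ (gamGW d m a')⁻¹ * ((sigGW d L m a') ^ 2)⁻¹ := by
  have hD := isUnit_det_DpGW L M k m layer a' hlay ha'
  have hB := opNorm_BhGW_le L M k m layer a' ha'.le hD
  have hK : ‖(KGW L M k m layer a')⁻¹‖ ≤ ((sigGW d L m a') ^ 2)⁻¹ := opNorm_inv_gramK_GW_le L M k m layer a' hD ha'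
  have hg := opNorm_GOmGW_le L M k m layer a' hlay ha'
  have hσ : 0 ≤ ((sigGW d L m a') ^ 2)⁻¹ := inv_nonneg.mpr (sq_nonneg _)
  calc ‖BhGW L M k m layer a' * (KGW L M k m layer a')⁻¹ * (BhGW L M k m layer a')ᴴ‖
      ≤ Real.sqrt ‖GOmGW L M k m layer a'‖ * ((sigGW d L m a') ^ 2)⁻¹ * Real.sqrt ‖GOmGW L M k m layer a'‖ :=
        opNorm_sandwich_le _ _ hB hK (Real.sqrt_nonneg _) hσ
    _ = ‖GOmGW L M k m layer a'‖ * ((sigGW d L m a') ^ 2)⁻¹ := by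
        rw [mul_right_comm, Real.mul_self_sqrt (norm_nonneg _)]
    _ ≤ (gamGW d m a')⁻¹ * ((sigGW d L m a') ^ 2)⁻¹ := mul_le_mul_of_nonneg_right hg hσ

end GaugeGW

/-! ## §2b The torus gauge sandwich `∂·PcT·∂ᴴ` and the unit line mass `a·Q*Q` -/

section Torus

variable (n : ℕ) [NeZero n] (M : Fin d → ℕ) [hM : ∀ μ, NeZero (M μ)]

/-- **THE TORUS GAUGE SANDWICH IS BOUNDED, LEVEL-FREE**: `‖∂·PcT·∂ᴴ‖ ≤ γ′⁻¹·σ₀⁻²` (any auxiliary `a′ > 0`; the substrate's factorisation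
`∂·PcT·∂ᴴ = (∂G′Q̃′ᴴ)·Kcomp⁻¹·(∂G′Q̃′ᴴ)ᴴ`). [cite: Balaban1984PropagatorsI, (1.70) p.30 (shape)] [folklore] -/
theorem opNorm_torusSandwich_le {a' : ℝ} (ha' : 0 < a') :
    ‖GradOp (fine n M) (n : ℂ) * PcT n M (n : ℂ) * (GradOp (fine n M) (n : ℂ))ᴴ‖ ≤ (gammaPs d a')⁻¹ * ((sigma0 d a') ^ 2)⁻¹ := by
  have hγ : 0 ≤ (gammaPs d a')⁻¹ := inv_nonneg.mpr (gammaPs_pos (d := d) (a' := a')).1.le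
  have e : GradOp (fine n M) (n : ℂ) * PcT n M (n : ℂ) * (GradOp (fine n M) (n : ℂ))ᴴ
      = (GradOp (fine n M) (n : ℂ) * Gps n M a') * (Qiso n M)ᴴ * (Kcomp n M a')⁻¹ * Qiso n M
          * (GradOp (fine n M) (n : ℂ) * Gps n M a')ᴴ := by
    rw [← GradOp_Pone_GradOpH_eq n M ha', Pone_eq_iso n M ha', Matrix.conjTranspose_mul, (Gps_isHermitian n M a').eq]
    simp only [Matrix.mul_assoc]
  have hX := opNorm_GradOp_mul_Gps_le n M ha'
  have hXt : ‖(GradOp (fine n M) (n : ℂ) * Gps n M a')ᴴ‖ ≤ Real.sqrt ((gammaPs d a')⁻¹) := by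
    rw [Matrix.l2_opNorm_conjTranspose]; exact hX
  have hQ := opNorm_Qiso_le n M
  have hQt : ‖(Qiso n M)ᴴ‖ ≤ 1 := by rw [Matrix.l2_opNorm_conjTranspose]; exact hQ
  have hK := opNorm_Kcomp_inv_le n M ha'
  rw [e]
  calc ‖GradOp (fine n M) (n : ℂ) * Gps n M a' * (Qiso n M)ᴴ * (Kcomp n M a')⁻¹ * Qiso n M * (GradOp (fine n M) (n : ℂ) * Gps n M a')ᴴ‖
      ≤ ‖GradOp (fine n M) (n : ℂ) * Gps n M a' * (Qiso n M)ᴴ * (Kcomp n M a')⁻¹ * Qiso n M‖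
          * ‖(GradOp (fine n M) (n : ℂ) * Gps n M a')ᴴ‖ := Matrix.l2_opNorm_mul _ _
    _ ≤ ‖GradOp (fine n M) (n : ℂ) * Gps n M a' * (Qiso n M)ᴴ * (Kcomp n M a')⁻¹‖ * ‖Qiso n M‖
          * ‖(GradOp (fine n M) (n : ℂ) * Gps n M a')ᴴ‖ :=
        mul_le_mul_of_nonneg_right (Matrix.l2_opNorm_mul _ _) (norm_nonneg _)
    _ ≤ ‖GradOp (fine n M) (n : ℂ) * Gps n M a' * (Qiso n M)ᴴ‖ * ‖(Kcomp n M a')⁻¹‖ * ‖Qiso n M‖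
          * ‖(GradOp (fine n M) (n : ℂ) * Gps n M a')ᴴ‖ := by
        gcongr; exact Matrix.l2_opNorm_mul _ _
    _ ≤ ‖GradOp (fine n M) (n : ℂ) * Gps n M a'‖ * ‖(Qiso n M)ᴴ‖ * ‖(Kcomp n M a')⁻¹‖ * ‖Qiso n M‖
          * ‖(GradOp (fine n M) (n : ℂ) * Gps n M a')ᴴ‖ := by
        gcongr; exact Matrix.l2_opNorm_mul _ _
    _ ≤ Real.sqrt ((gammaPs d a')⁻¹) * 1 * ((sigma0 d a') ^ 2)⁻¹ * 1 * Real.sqrt ((gammaPs d a')⁻¹) := by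
        gcongr
    _ = (gammaPs d a')⁻¹ * ((sigma0 d a') ^ 2)⁻¹ := by
        rw [mul_one, mul_one, mul_right_comm, Real.mul_self_sqrt hγ]

/-- **THE UNIT LINE MASS IS BOUNDED BY THE COUPLING**: `‖a·Q*_kQ_k‖ ≤ a` (`Q*_k = n^d·Q_kᴴ`, `‖Q_k‖ ≤ n^{−d/2}`).
[cite: Balaban1984PropagatorsI, (1.18) p.20 (shape)] [folklore] -/
theorem opNorm_unitMass_le {a : ℝ} (ha : 0 ≤ a) : ‖(a : ℂ) • (QvAdj n M * QvOp n M)‖ ≤ a := by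
  have hn : (0 : ℝ) < (n : ℝ) ^ d := pow_pos (by exact_mod_cast Nat.pos_of_ne_zero (NeZero.ne n)) d
  have hQ := opNorm_QvOp_le n M
  have hQt : ‖(QvOp n M)ᴴ‖ ≤ (Real.sqrt ((n : ℝ) ^ d))⁻¹ := by rw [Matrix.l2_opNorm_conjTranspose]; exact hQ
  have h0 : 0 ≤ (Real.sqrt ((n : ℝ) ^ d))⁻¹ := inv_nonneg.mpr (Real.sqrt_nonneg _)
  have h1 : ‖(QvOp n M)ᴴ * QvOp n M‖ ≤ ((n : ℝ) ^ d)⁻¹ :=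
    calc ‖(QvOp n M)ᴴ * QvOp n M‖ ≤ ‖(QvOp n M)ᴴ‖ * ‖QvOp n M‖ := Matrix.l2_opNorm_mul _ _
      _ ≤ (Real.sqrt ((n : ℝ) ^ d))⁻¹ * (Real.sqrt ((n : ℝ) ^ d))⁻¹ := mul_le_mul hQt hQ (norm_nonneg _) h0
      _ = ((n : ℝ) ^ d)⁻¹ := by rw [← mul_inv, Real.mul_self_sqrt hn.le]
  unfold QvAdj
  rw [Matrix.smul_mul, norm_smul, norm_smul, Complex.norm_real, Real.norm_of_nonneg ha, norm_pow, Complex.norm_natCast]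
  calc a * ((n : ℝ) ^ d * ‖(QvOp n M)ᴴ * QvOp n M‖) ≤ a * ((n : ℝ) ^ d * ((n : ℝ) ^ d)⁻¹) := by gcongr
    _ = a := by rw [mul_inv_cancel₀ hn.ne', mul_one]

end Torus

/-! ## §2c The graded line mass `Q_GWᴴQ_GW` (per scale `‖w_i·Q_{s_i}‖² ≤ L^{2i}`, leaf-01-g11's Schur bound `‖Q_s‖ ≤ s^{−d/2}`) -/

section MassGW

variable (L : ℕ) [NeZero L] (M : Fin d → ℕ) [hM : ∀ μ, NeZero (M μ)] (k m : ℕ) (layer : Tor M → ℕ)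

/-- the typed vector rows have decidable equality (column index of `Q_GWᴴ`). [folklore] -/
instance instDecidableEqRowV : DecidableEq (RowV L M k m layer) := inferInstance

/-- the graded-mass constant `Σ_{i ≤ m} L^{2i}` (= `Σ_i w_i²·s_i^{−d}`). [folklore] -/
def cMass (L m : ℕ) : ℝ := ∑ i : Fin (m + 1), (L : ℝ) ^ (2 * (i : ℕ))

omit [NeZero L] in
/-- `0 ≤ cMass`. [folklore] -/
theorem cMass_nonneg : 0 ≤ cMass L m := Finset.sum_nonneg fun _ _ => pow_nonneg (Nat.cast_nonneg _) _

/-- `w_i²·‖Q_{s_i}‖² ≤ L^{2i}`. [folklore] -/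
theorem wGW_sq_mul_opNorm_avgS_sq_le (i : ℕ) :
    wGW L k d i ^ 2 * ‖avgS (fine (lev L k) M) (sGW L k i)‖ ^ 2 ≤ (L : ℝ) ^ (2 * i) := by
  have hs : (0 : ℝ) < ((sGW L k i : ℕ) : ℝ) ^ d := pow_pos (by exact_mod_cast s_pos (sGW L k i)) d
  have h := opNorm_avgS_le (fine (lev L k) M) (sGW L k i) (sGW_dvd L M k i)
  have h2 : ‖avgS (fine (lev L k) M) (sGW L k i)‖ ^ 2 ≤ (((sGW L k i : ℕ) : ℝ) ^ d)⁻¹ := by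
    calc ‖avgS (fine (lev L k) M) (sGW L k i)‖ ^ 2 ≤ ((Real.sqrt (((sGW L k i : ℕ) : ℝ) ^ d))⁻¹) ^ 2 :=
          pow_le_pow_left₀ (norm_nonneg _) h 2
      _ = (((sGW L k i : ℕ) : ℝ) ^ d)⁻¹ := by rw [inv_pow, Real.sq_sqrt hs.le]
  calc wGW L k d i ^ 2 * ‖avgS (fine (lev L k) M) (sGW L k i)‖ ^ 2
      ≤ wGW L k d i ^ 2 * (((sGW L k i : ℕ) : ℝ) ^ d)⁻¹ := mul_le_mul_of_nonneg_left h2 (sq_nonneg _)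
    _ = (L : ℝ) ^ (2 * i) := by rw [wGW_sq, mul_assoc, mul_inv_cancel₀ hs.ne', mul_one]

/-- **THE GRADED LINE MASS IS BOUNDED, LEVEL-FREE**: `nsq (Q_GW A) ≤ (Σ_{i≤m} L^{2i})·nsq A` (every typed row is a row; per scale
`‖w_i·Q_{s_i}‖² ≤ L^{2i}`). [cite: Balaban1985BackgroundPropagators, (3.16) p.393 (shape)] [folklore] -/
theorem nsq_QvGW_le (A : TorK L M k × Fin d → ℂ) : nsq (QvGW L M k m layer *ᵥ A) ≤ cMass L m * nsq A := by
  let F : ((i : Fin (m + 1)) × (Anc (fine (lev L k) M) (sGW L k i) × Fin d)) → ℝ :=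
    fun q => wGW L k d q.1 ^ 2 * ‖(avgS (fine (lev L k) M) (sGW L k q.1) *ᵥ A) q.2‖ ^ 2
  have hF : ∀ q, 0 ≤ F q := fun q => mul_nonneg (sq_nonneg _) (sq_nonneg _)
  have e1 : ∀ p : RowV L M k m layer, ‖(QvGW L M k m layer *ᵥ A) p‖ ^ 2 = F p.1 := by
    intro p
    have e : (QvGW L M k m layer *ᵥ A) p = ((wGW L k d p.1.1 : ℝ) : ℂ) * (avgS (fine (lev L k) M) (sGW L k p.1.1) *ᵥ A) p.1.2 := by
      simp only [Matrix.mulVec, dotProduct, QvGW, mul_assoc, ← Finset.mul_sum]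
    rw [e, norm_mul, mul_pow, Complex.norm_real, Real.norm_of_nonneg (wGW_nonneg L k d p.1.1)]
  have step1 : nsq (QvGW L M k m layer *ᵥ A) ≤ ∑ q, F q := by
    unfold nsq
    rw [Finset.sum_congr rfl fun p _ => e1 p]
    let P : ((i : Fin (m + 1)) × (Anc (fine (lev L k) M) (sGW L k i) × Fin d)) → Prop := fun q =>
      min (layer (blockOf (lev L k) M q.2.1.1))
          (layer (blockOf (lev L k) M (shiftAnc (fine (lev L k) M) (sGW L k q.1) (sGW_dvd L M k q.1) q.2.2 q.2.1).1)) = q.1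
    have key : ∑ q ∈ Finset.univ.filter P, F q = ∑ p : RowV L M k m layer, F p.1 :=
      Finset.sum_subtype (Finset.univ.filter P) (by intro x; simp [P]) F
    rw [← key]
    exact Finset.sum_le_sum_of_subset_of_nonneg (Finset.filter_subset _ _) fun q _ _ => hF q
  have step2 : ∑ q, F q = ∑ i : Fin (m + 1), wGW L k d i ^ 2 * nsq (avgS (fine (lev L k) M) (sGW L k i) *ᵥ A) := by
    rw [Fintype.sum_sigma]
    refine Finset.sum_congr rfl fun i _ => ?_
    unfold nsq
    rw [Finset.mul_sum]
  have step3 : ∀ i : Fin (m + 1), wGW L k d i ^ 2 * nsq (avgS (fine (lev L k) M) (sGW L k i) *ᵥ A) ≤ (L : ℝ) ^ (2 * (i : ℕ)) * nsq A := by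
    intro i
    calc wGW L k d i ^ 2 * nsq (avgS (fine (lev L k) M) (sGW L k i) *ᵥ A)
        ≤ wGW L k d i ^ 2 * (‖avgS (fine (lev L k) M) (sGW L k i)‖ ^ 2 * nsq A) :=
          mul_le_mul_of_nonneg_left (nsq_mulVec_le_rect _ _) (sq_nonneg _)
      _ = (wGW L k d i ^ 2 * ‖avgS (fine (lev L k) M) (sGW L k i)‖ ^ 2) * nsq A := by ring
      _ ≤ (L : ℝ) ^ (2 * (i : ℕ)) * nsq A := mul_le_mul_of_nonneg_right (wGW_sq_mul_opNorm_avgS_sq_le L M k i) (nsq_nonneg _)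
  calc nsq (QvGW L M k m layer *ᵥ A) ≤ ∑ q, F q := step1
    _ = ∑ i : Fin (m + 1), wGW L k d i ^ 2 * nsq (avgS (fine (lev L k) M) (sGW L k i) *ᵥ A) := step2
    _ ≤ ∑ i : Fin (m + 1), (L : ℝ) ^ (2 * (i : ℕ)) * nsq A := Finset.sum_le_sum fun i _ => step3 i
    _ = cMass L m * nsq A := by rw [cMass, Finset.sum_mul]

/-- `‖Q_GW‖ ≤ √(Σ_{i≤m} L^{2i})`. [folklore] -/
theorem opNorm_QvGW_le : ‖QvGW L M k m layer‖ ≤ Real.sqrt (cMass L m) :=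
  opNorm_le_of_nsq_le_rect _ (Real.sqrt_nonneg _) fun A => by
    rw [Real.sq_sqrt (cMass_nonneg L m)]; exact nsq_QvGW_le L M k m layer A

/-- **`‖Q_GWᴴQ_GW‖ ≤ Σ_{i≤m} L^{2i}`** — LEVEL-FREE. [folklore] -/
theorem opNorm_massGW_le : ‖(QvGW L M k m layer)ᴴ * QvGW L M k m layer‖ ≤ cMass L m := by
  have h := opNorm_QvGW_le L M k m layer
  have ht : ‖(QvGW L M k m layer)ᴴ‖ ≤ Real.sqrt (cMass L m) := by rw [Matrix.l2_opNorm_conjTranspose]; exact h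
  calc ‖(QvGW L M k m layer)ᴴ * QvGW L M k m layer‖ ≤ ‖(QvGW L M k m layer)ᴴ‖ * ‖QvGW L M k m layer‖ := Matrix.l2_opNorm_mul _ _
    _ ≤ Real.sqrt (cMass L m) * Real.sqrt (cMass L m) := mul_le_mul ht h (norm_nonneg _) (Real.sqrt_nonneg _)
    _ = cMass L m := Real.mul_self_sqrt (cMass_nonneg L m)

end MassGW


/-! ## §3 `‖E_k‖ ≤ eGW` for every level, and the torus transfer with `hE` discharged -/

section Main

variable (L : ℕ) [NeZero L] (M : Fin d → ℕ) [hM : ∀ μ, NeZero (M μ)] (k m : ℕ) (layer : Tor M → ℕ) (a a' : ℝ) (ha : 0 < a)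

/-- **THE LEVEL-FREE BOUND OF THE DIFFERENCE**: `eGW = gamGW⁻¹·sigGW⁻² + γ′⁻¹·σ₀⁻² + a·(1 + Σ_{i≤m} L^{2i})` (depends on `d, L, m, a, a′`
only). [folklore] -/
def eGW (d L m : ℕ) (a a' : ℝ) : ℝ :=
  (gamGW d m a')⁻¹ * ((sigGW d L m a') ^ 2)⁻¹ + (gammaPs d a')⁻¹ * ((sigma0 d a') ^ 2)⁻¹ + a * (1 + cMass L m)

omit [NeZero L] in
/-- `0 ≤ eGW` (`0 ≤ a`, `0 < a′`). [folklore] -/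
theorem eGW_nonneg (ha0 : 0 ≤ a) (ha' : 0 < a') : 0 ≤ eGW d L m a a' := by
  have h1 : 0 ≤ (gamGW d m a')⁻¹ := inv_nonneg.mpr (gamGW_pos m a' (d := d) ha').le
  have h2 : 0 ≤ ((sigGW d L m a') ^ 2)⁻¹ := inv_nonneg.mpr (sq_nonneg _)
  have h3 : 0 ≤ (gammaPs d a')⁻¹ := inv_nonneg.mpr (gammaPs_pos (d := d) (a' := a')).1.le
  have h4 : 0 ≤ ((sigma0 d a') ^ 2)⁻¹ := inv_nonneg.mpr (sq_nonneg _)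
  have h5 := cMass_nonneg L m
  unfold eGW
  positivity

/-- **`‖E_k‖ ≤ eGW` FOR EVERY LEVEL `k`** — the hypothesis `hE` of the torus transfer, DISCHARGED (no displayed binder).
[cite: Balaban1984PropagatorsI, (1.69) p.29 (shape)] [folklore] -/
theorem opNorm_EGW_le (hlay : ∀ y, layer y ≤ m) (ha' : 0 < a') (k : ℕ) :
    ‖EGW L M k m layer a a' ha‖ ≤ eGW d L m a a' := by
  rw [EGW_eq]
  have h1 := opNorm_sandwichGW_le L M k m layer a' hlay ha'
  have h2 := opNorm_torusSandwich_le (lev L k) M ha'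
  have h3 := opNorm_unitMass_le (lev L k) M ha.le
  have h4 : ‖(a : ℂ) • ((QvGW L M k m layer)ᴴ * QvGW L M k m layer)‖ ≤ a * cMass L m := by
    rw [norm_smul, Complex.norm_real, Real.norm_of_nonneg ha.le]
    exact mul_le_mul_of_nonneg_left (opNorm_massGW_le L M k m layer) ha.le
  calc ‖BhGW L M k m layer a' * (KGW L M k m layer a')⁻¹ * (BhGW L M k m layer a')ᴴ
          - gradT L M k * PcT (lev L k) M ((lev L k : ℕ) : ℂ) * (gradT L M k)ᴴ
          + (a : ℂ) • (QvAdj (lev L k) M * QvOp (lev L k) M)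
          - (a : ℂ) • ((QvGW L M k m layer)ᴴ * QvGW L M k m layer)‖
      ≤ ‖BhGW L M k m layer a' * (KGW L M k m layer a')⁻¹ * (BhGW L M k m layer a')ᴴ
          - gradT L M k * PcT (lev L k) M ((lev L k : ℕ) : ℂ) * (gradT L M k)ᴴ
          + (a : ℂ) • (QvAdj (lev L k) M * QvOp (lev L k) M)‖
        + ‖(a : ℂ) • ((QvGW L M k m layer)ᴴ * QvGW L M k m layer)‖ := norm_sub_le _ _
    _ ≤ (‖BhGW L M k m layer a' * (KGW L M k m layer a')⁻¹ * (BhGW L M k m layer a')ᴴ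
          - gradT L M k * PcT (lev L k) M ((lev L k : ℕ) : ℂ) * (gradT L M k)ᴴ‖
          + ‖(a : ℂ) • (QvAdj (lev L k) M * QvOp (lev L k) M)‖)
        + ‖(a : ℂ) • ((QvGW L M k m layer)ᴴ * QvGW L M k m layer)‖ := by
        gcongr; exact norm_add_le _ _
    _ ≤ ((‖BhGW L M k m layer a' * (KGW L M k m layer a')⁻¹ * (BhGW L M k m layer a')ᴴ‖
          + ‖gradT L M k * PcT (lev L k) M ((lev L k : ℕ) : ℂ) * (gradT L M k)ᴴ‖)
          + ‖(a : ℂ) • (QvAdj (lev L k) M * QvOp (lev L k) M)‖)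
        + ‖(a : ℂ) • ((QvGW L M k m layer)ᴴ * QvGW L M k m layer)‖ := by
        gcongr; exact norm_sub_le _ _
    _ ≤ (((gamGW d m a')⁻¹ * ((sigGW d L m a') ^ 2)⁻¹ + (gammaPs d a')⁻¹ * ((sigma0 d a') ^ 2)⁻¹) + a) + a * cMass L m := by
        gcongr
    _ = eGW d L m a a' := by unfold eGW; ring

/-- **THE TORUS TRANSFER WITH `hE` DISCHARGED** (levels `k ≥ m`; `L⁻¹ ≤ θ`): `‖G_GW(k+1)·J_k − J_k·G_GW(k)‖ ≤ C1T(γ, eGW, Ce)·θ^k` from the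
coercivity `γ` of `regionGW` ((GW-W1)+(GW-S0)) and ONE two-level leaf (GW-E) — `GradedWellTorusTransfer.hinjK_GW_of_torus` with `e := eGW`.
[folklore] -/
theorem hinjK_GW_of_torus_E (hlay : ∀ y, layer y ≤ m) (ha' : 0 < a') {γ θ Ce : ℝ} (hγ : 0 < γ) (hθ : (L : ℝ)⁻¹ ≤ θ)
    (hco : ∀ k, m ≤ k → Coercive (regionGW L M k m layer a a') γ)
    (hEc : ∀ k, m ≤ k →
      ‖EGW L M (k + 1) m layer a a' ha * JpcT L M k - JpcT L M k * EGW L M k m layer a a' ha‖ ≤ Ce * θ ^ k)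
    (k : ℕ) (hk : m ≤ k) :
    ‖(regionGW L M (k + 1) m layer a a')⁻¹ * JpcT L M k - JpcT L M k * (regionGW L M k m layer a a')⁻¹‖
      ≤ C1T d a γ (eGW d L m a a') Ce * θ ^ k :=
  hinjK_GW_of_torus L M m layer a a' ha hγ (eGW_nonneg L m a a' ha.le ha') hθ hco
    (fun k _ => opNorm_EGW_le L M m layer a a' ha hlay ha' k) hEc k hk

end Main

end Summit.QuantumFields.BalabanUV.T4Continuum.GradedWellDifference

end
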